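import Literature.Analysis.FluidPDE.LocalLeraySolutions
import Literature.Analysis.FluidPDE.SobolevSixBall
import HarnessLib

/-!
# Decay of the cubic functional `∫₀ᵀ ∫_{B_ρ(y)} |v|³` at spatial infinity for local Leray solutions
(Kikuchi–Seregin 2007, Lemma 2.2; Kang–Miura–Tsai 2021, Lemma 3.3, the velocity part)

Analysis/FluidPDE proof file in the decomposition of the named fact
`Literature.Analysis.FluidPDE.leray_solution_ckn_decay` (**D**,
`LerayFarFieldEpsilonRegularity.lean`: for a local Leray solution `(v, π)` with `L³` datum there
are gauges `c_{x₀} ∈ L^{3/2}(0,T)` with `∫₀ᵀ ∫_{B_{3/2}(x₀)} (|v|³ + |π - c_{x₀}|^{3/2}) → 0` as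
`|x₀| → ∞`; Kang–Miura–Tsai, IMRN 2021 = arXiv:1812.10509, Lemma 3.3 = Kikuchi–Seregin 2007,
Lemma 2.2, with Lemma 3.4). The decay estimate of Lemma 3.3 bounds four quantities,
`sup_t α_R`, `β_R`, `γ_R` (the cubic functional of the cut-off velocity) and `δ_R` (the gauged
pressure); this file **proves the decay of the velocity part `γ`** directly from the defining
properties (2) and (7) of a local Leray solution in the sense of Kang–Miura–Tsai Def. 3.2 (the
tree's `IsLocalLeraySolution`): for every viscosity `ν`, every datum, every `T` and every
radius `ρ`,

* `IsLocalLeraySolution.tendsto_lintegral_cube_cocompact` —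
  `∫₀ᵀ ∫_{B_ρ(y)} |v|³ dx dt → 0` as `|y| → ∞` (`Filter.cocompact ℝ³`).

Proof ("It is standard to see that `A` is finite by using properties 2–5 and the Sobolev
embedding", KMT after Lemma 3.3; Lemarié-Rieusset 2016, proof of Thm. 14.5, p. 511, the bound
on `sup_{|x|>R} ∫₀^{T₀}∫_{|x-y|<1} |u|³` by `L^∞L²` and `L²Ḣ¹` quantities). Fix `R ≥ max(ρ, 1)`
with `R² ≥ T`; by (2) there are `C₁, C₂` with `∫_{B_R(x₀)} |v(s)|² ≤ C₁` for a.e. `s < R²` and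
`∫₀^{R²}∫_{B_R(x₀)} |∇v|² ≤ C₂`, for all `x₀`. For a.e. `s ∈ (0, T)` the slice `v(s)` has the
weak derivative `∇v(s) = G(s)` on `B = B_ρ(y)`
(`HasWeakSpatialGradientOn.ae_hasWeakFDerivOn_slice`), so by Lebesgue interpolation and the
Sobolev inequality on `B` with a constant `C_S = C_S(ρ)` independent of the centre
(`exists_eLpNorm_six_le_ball_uniform`),
`∫_B |v(s)|³ ≤ (∫_B |v(s)|²)^{3/4} ‖v(s)‖^{3/2}_{L⁶(B)} ≤ (2C_S)^{3/2} a^{3/4} (a + e)^{3/4}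
≤ (2C_S)^{3/2} C₁^{1/2} a^{1/4} (a + e)^{3/4}` with `a = a(s) = ∫_B |v(s)|²`,
`e = e(s) = ∫_B |G(s)|²`. Integrating in `s ∈ (0,T)` (Tonelli) and using Hölder with exponents
`4, 4/3`, `∫₀ᵀ∫_B |v|³ ≤ (2C_S)^{3/2} C₁^{1/2} (∫₀ᵀ a)^{1/4} (∫₀ᵀ (a + e))^{3/4}
≤ K (∫₀ᵀ∫_B |v|²)^{1/4}` with `K = (2C_S)^{3/2} C₁^{1/2} (C₁ T + C₂)^{3/4}` independent of
`y`, and `∫₀ᵀ∫_{B_ρ(y)} |v|² ≤ ∫₀^{R²}∫_{B_R(y)} |v|² → 0` by (7).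

## Mathlib / tree search

Tree: `lintegral_pow_three_le_Lp_interpolation` (`CKNInterpolationEstimate.lean`),
`exists_eLpNorm_six_le_ball_uniform` (`SobolevSixBall.lean`),
`HasWeakSpatialGradientOn.ae_hasWeakFDerivOn_slice` (`WeakGradientSlicing.lean`),
`continuous_frobeniusNormSq'`; the tree's `interpolationEstimate_holds`
(`C(r) ≤ C₀ (A + E)^{3/2}`) has no `L²`-smallness factor and does not give decay. Mathlib:
`ENNReal.lintegral_mul_le_Lp_mul_Lq`, `lintegral_prod`, `AEMeasurable.lintegral_prod_right'`,
`Measure.prod_restrict`, `ENNReal.Tendsto.const_mul`, `ENNReal.continuous_rpow_const`.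

## References

* K. Kang, H. Miura, T.-P. Tsai, IMRN 2021 = arXiv:1812.10509, §3, Def. 3.2, Lemma 3.3 (and
  the remark after it). Bib key `KangMiuraTsai2020`.
* N. Kikuchi, G. Seregin, AMS Transl. (2) 220 (2007), Lemma 2.2. Bib key `KikuchiSeregin2007`.
* P. G. Lemarié-Rieusset, *The Navier–Stokes problem in the 21st century*, CRC Press (2016),
  proof of Thm. 14.5, p. 511. Bib key `LemarieRieusset2016`.
-/

noncomputable section

open _root_.MeasureTheory _root_.TopologicalSpace _root_.Metric _root_.Filter _root_.Set
  _root_.Function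
open scoped _root_.ENNReal _root_.NNReal _root_.Topology

namespace Literature.Analysis.FluidPDE

/-! ## Tools: `L²` and `L⁶` norms, Hölder in time, the slice estimate -/

section Tools

variable {α : Type*} [MeasurableSpace α] {F : Type*} [NormedAddCommGroup F]

/-- `‖f‖_{L²} = (∫ |f|²)^{1/2}` with a natural-number exponent inside. [folklore] -/
theorem eLpNorm_two_eq_rpow_lintegral_sq (f : α → F) (μ : Measure α) :
    eLpNorm f 2 μ = (∫⁻ x, ‖f x‖ₑ ^ (2 : ℕ) ∂μ) ^ (1 / 2 : ℝ) := by
  rw [eLpNorm_eq_lintegral_rpow_enorm_toReal two_ne_zero ENNReal.ofNat_ne_top,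
    ENNReal.toReal_ofNat]
  congr 1
  refine lintegral_congr fun x => ?_
  rw [show (2 : ℝ) = ((2 : ℕ) : ℝ) by norm_num, ENNReal.rpow_natCast]

/-- `∫ |f|⁶ = ‖f‖_{L⁶}⁶`. [folklore] -/
theorem lintegral_rpow_six_eq_eLpNorm_rpow (f : α → F) (μ : Measure α) :
    (∫⁻ x, ‖f x‖ₑ ^ (6 : ℝ) ∂μ) = eLpNorm f 6 μ ^ (6 : ℝ) := by
  rw [eLpNorm_eq_lintegral_rpow_enorm_toReal (by norm_num) ENNReal.ofNat_ne_top,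
    ENNReal.toReal_ofNat, ← ENNReal.rpow_mul]
  norm_num

/-- Hölder in time with exponents `4` and `4/3`:
`∫ a^{1/4} b^{3/4} ≤ (∫ a)^{1/4} (∫ b)^{3/4}`. [folklore] -/
theorem lintegral_rpow_quarter_mul_le (μ : Measure α) {a b : α → ℝ≥0∞}
    (ha : AEMeasurable a μ) (hb : AEMeasurable b μ) :
    ∫⁻ s, a s ^ (1 / 4 : ℝ) * b s ^ (3 / 4 : ℝ) ∂μ ≤
      (∫⁻ s, a s ∂μ) ^ (1 / 4 : ℝ) * (∫⁻ s, b s ∂μ) ^ (3 / 4 : ℝ) := by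
  have hpq : (4 : ℝ).HolderConjugate (4 / 3) :=
    Real.holderConjugate_iff.2 ⟨by norm_num, by norm_num⟩
  have key := ENNReal.lintegral_mul_le_Lp_mul_Lq μ hpq (ha.pow_const (1 / 4 : ℝ))
    (hb.pow_const (3 / 4 : ℝ))
  have h1 : ∀ s, (a s ^ (1 / 4 : ℝ)) ^ (4 : ℝ) = a s := fun s => by
    rw [← ENNReal.rpow_mul]; norm_num
  have h2 : ∀ s, (b s ^ (3 / 4 : ℝ)) ^ (4 / 3 : ℝ) = b s := fun s => by
    rw [← ENNReal.rpow_mul]; norm_num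
  simp only [Pi.mul_apply, h1, h2] at key
  rw [show (1 : ℝ) / 4 = 1 / 4 by norm_num, show (1 : ℝ) / (4 / 3) = 3 / 4 by norm_num] at key
  exact key

/-- **The slice estimate.** If `‖f‖_{L⁶(μ)} ≤ C (‖f‖_{L²(μ)} + e^{1/2})` (the Sobolev inequality
for `f` on a ball, `e = ∫ |∇f|²`), then
`∫ |f|³ dμ ≤ (2C)^{3/2} (∫ |f|² dμ)^{3/4} (∫ |f|² dμ + e)^{3/4}`: Lebesgue interpolation
`∫ |f|³ ≤ (∫ |f|²)^{3/4} (∫ |f|⁶)^{1/4}` and `(∫ |f|⁶)^{1/4} = ‖f‖_{L⁶}^{3/2}`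
(Robinson–Rodrigo–Sadowski 2016, proof of Lemma 15.10; Caffarelli–Kohn–Nirenberg 1982,
(2.8)–(2.10)). [folklore] -/
theorem lintegral_cube_le_of_sobolev (μ : Measure α) {C : ℝ≥0} {f : α → F} {e : ℝ≥0∞}
    (hS : eLpNorm f 6 μ ≤ C * (eLpNorm f 2 μ + e ^ (1 / 2 : ℝ)))
    (hfm : AEStronglyMeasurable f μ) :
    ∫⁻ x, ‖f x‖ₑ ^ (3 : ℕ) ∂μ ≤
      ((2 : ℝ≥0∞) * C) ^ (3 / 2 : ℝ) * (∫⁻ x, ‖f x‖ₑ ^ (2 : ℕ) ∂μ) ^ (3 / 4 : ℝ) *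
        ((∫⁻ x, ‖f x‖ₑ ^ (2 : ℕ) ∂μ) + e) ^ (3 / 4 : ℝ) := by
  set a : ℝ≥0∞ := ∫⁻ x, ‖f x‖ₑ ^ (2 : ℕ) ∂μ with ha
  set S : ℝ≥0∞ := eLpNorm f 6 μ with hSdef
  -- Lebesgue interpolation
  have h1 : ∫⁻ x, ‖f x‖ₑ ^ (3 : ℕ) ∂μ ≤
      a ^ (3 / 4 : ℝ) * (∫⁻ x, ‖f x‖ₑ ^ (6 : ℝ) ∂μ) ^ (1 / 4 : ℝ) :=
    lintegral_pow_three_le_Lp_interpolation μ hfm.enorm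
  have h6 : (∫⁻ x, ‖f x‖ₑ ^ (6 : ℝ) ∂μ) ^ (1 / 4 : ℝ) = S ^ (3 / 2 : ℝ) := by
    rw [lintegral_rpow_six_eq_eLpNorm_rpow, ← ENNReal.rpow_mul, ← hSdef]
    norm_num
  rw [h6] at h1
  -- the Sobolev bound in terms of `a` and `e`
  have h2 : eLpNorm f 2 μ = a ^ (1 / 2 : ℝ) := eLpNorm_two_eq_rpow_lintegral_sq f μ
  have hS' : S ≤ (2 : ℝ≥0∞) * C * (a + e) ^ (1 / 2 : ℝ) := by
    refine hS.trans ?_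
    rw [h2]
    have ha' : a ^ (1 / 2 : ℝ) ≤ (a + e) ^ (1 / 2 : ℝ) :=
      ENNReal.rpow_le_rpow le_self_add (by norm_num)
    have he' : e ^ (1 / 2 : ℝ) ≤ (a + e) ^ (1 / 2 : ℝ) :=
      ENNReal.rpow_le_rpow le_add_self (by norm_num)
    calc (C : ℝ≥0∞) * (a ^ (1 / 2 : ℝ) + e ^ (1 / 2 : ℝ))
        ≤ C * ((a + e) ^ (1 / 2 : ℝ) + (a + e) ^ (1 / 2 : ℝ)) := by gcongr
      _ = 2 * C * (a + e) ^ (1 / 2 : ℝ) := by ring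
  have hS32 :
      S ^ (3 / 2 : ℝ) ≤ ((2 : ℝ≥0∞) * C) ^ (3 / 2 : ℝ) * (a + e) ^ (3 / 4 : ℝ) := by
    calc S ^ (3 / 2 : ℝ) ≤ ((2 : ℝ≥0∞) * C * (a + e) ^ (1 / 2 : ℝ)) ^ (3 / 2 : ℝ) :=
          ENNReal.rpow_le_rpow hS' (by norm_num)
      _ = ((2 : ℝ≥0∞) * C) ^ (3 / 2 : ℝ) * ((a + e) ^ (1 / 2 : ℝ)) ^ (3 / 2 : ℝ) :=
          ENNReal.mul_rpow_of_nonneg _ _ (by norm_num)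
      _ = ((2 : ℝ≥0∞) * C) ^ (3 / 2 : ℝ) * (a + e) ^ (3 / 4 : ℝ) := by
          rw [← ENNReal.rpow_mul]
          norm_num
  calc ∫⁻ x, ‖f x‖ₑ ^ (3 : ℕ) ∂μ ≤ a ^ (3 / 4 : ℝ) * S ^ (3 / 2 : ℝ) := h1
    _ ≤ a ^ (3 / 4 : ℝ) * (((2 : ℝ≥0∞) * C) ^ (3 / 2 : ℝ) * (a + e) ^ (3 / 4 : ℝ)) := by
        gcongr
    _ = ((2 : ℝ≥0∞) * C) ^ (3 / 2 : ℝ) * a ^ (3 / 4 : ℝ) * (a + e) ^ (3 / 4 : ℝ) := by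
        ring

end Tools

/-! ## The decay of the cubic functional -/

/-- **Decay of `∫₀ᵀ ∫_{B_ρ(y)} |v|³` at spatial infinity for local Leray solutions**
(Kang–Miura–Tsai, IMRN 2021 = arXiv:1812.10509, Lemma 3.3 = Kikuchi–Seregin 2007, Lemma 2.2,
the `γ_R` part: `γ_R^{2/3}(T) ≤ C(T,A)(‖χ_R v₀‖²_{L²_uloc} + R^{-2/3})`; here for the tree's class
`IsLocalLeraySolution` of Def. 3.2 and in qualitative form). Let `(v, π)` be a local Leray
solution (any viscosity, any datum). Then for every `T` and every radius `ρ`,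
`∫₀ᵀ ∫_{B_ρ(y)} |v|³ dx dt → 0` as `|y| → ∞` (trivially so for `T ≤ 0` or `ρ ≤ 0`). Real
proof from the defining properties (2)
(uniformly local energy and gradient bounds) and (7) (`L²` decay at spatial infinity) of
Def. 3.2, by the slice-wise Sobolev inequality on `B_ρ(y)` with a centre-independent constant,
Lebesgue interpolation and Hölder in time; see the file docstring.
[cite: KangMiuraTsai2020, Lemma 3.3 (= KikuchiSeregin2007 Lemma 2.2), arXiv:1812.10509 p. 7, velocity part] -/
theorem IsLocalLeraySolution.tendsto_lintegral_cube_cocompact {ν : ℝ} {u₀ v π}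
    (hv : IsLocalLeraySolution ν u₀ v π) (ρ T : ℝ) :
    Tendsto (fun y => ∫⁻ z in Ioo 0 T ×ˢ ball y ρ, ‖v z.1 z.2‖ₑ ^ (3 : ℕ))
      (cocompact (EuclideanSpace ℝ (Fin 3))) (𝓝 0) := by
  -- ## a radius `R` with `ρ ≤ R`, `1 ≤ R`, `T ≤ R²`
  set R : ℝ := max ρ (max T 1) with hR
  have hR1 : 1 ≤ R := le_trans (le_max_right T 1) (le_max_right _ _)
  have hRpos : 0 < R := by linarith
  have hρR : ρ ≤ R := le_max_left _ _
  have hTR' : T ≤ R := le_trans (le_max_left T 1) (le_max_right _ _)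
  have hTR : T ≤ R ^ 2 := by nlinarith
  -- ## the data (2) and (7) of Def. 3.2, the Sobolev constant of `B_ρ`
  obtain ⟨C₁, hC₁⟩ := hv.uniformLocalEnergy R hRpos
  obtain ⟨G, hG, hGb⟩ := hv.uniformLocalGradient
  obtain ⟨C₂, hC₂⟩ := hGb R hRpos
  have hdec := hv.decay R hRpos
  obtain ⟨CS, hCS⟩ := exists_eLpNorm_six_le_ball_uniform finrank_euclideanSpace_three ρ
  -- ## constants
  set C₃ : ℝ≥0∞ := ((2 : ℝ≥0∞) * CS) ^ (3 / 2 : ℝ) * (C₁ : ℝ≥0∞) ^ (1 / 2 : ℝ)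
    with hC₃
  have hC₃top : C₃ ≠ ∞ :=
    ENNReal.mul_ne_top (ENNReal.rpow_ne_top_of_nonneg (by norm_num)
      (ENNReal.mul_ne_top (by simp) ENNReal.coe_ne_top))
      (ENNReal.rpow_ne_top_of_nonneg (by norm_num) ENNReal.coe_ne_top)
  set K : ℝ≥0∞ := C₃ * ((C₁ : ℝ≥0∞) * ENNReal.ofReal T + C₂) ^ (3 / 4 : ℝ) with hK
  have hKtop : K ≠ ∞ :=
    ENNReal.mul_ne_top hC₃top (ENNReal.rpow_ne_top_of_nonneg (by norm_num)
      (ENNReal.add_ne_top.2 ⟨ENNReal.mul_ne_top ENNReal.coe_ne_top ENNReal.ofReal_ne_top,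
        ENNReal.coe_ne_top⟩))
  -- ## measurability of `v` and `G` on the slab
  have hslab : ((slab (EuclideanSpace ℝ (Fin 3)) (Ioi 0) isOpen_Ioi :
      Opens (ℝ × EuclideanSpace ℝ (Fin 3))) : Set (ℝ × EuclideanSpace ℝ (Fin 3))) =
      Ioi (0 : ℝ) ×ˢ univ := rfl
  have hvm : AEStronglyMeasurable (uncurry v) (volume.restrict (Ioi (0 : ℝ) ×ˢ univ)) :=
    hv.aestronglyMeasurable
  have hGm : AEStronglyMeasurable (uncurry G) (volume.restrict (Ioi (0 : ℝ) ×ˢ univ)) := by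
    rw [← hslab]
    exact hG.locallyIntegrableOn_grad.aestronglyMeasurable
  -- ## the bound at one centre `y`, uniform in `y`
  have key : ∀ y, ∫⁻ z in Ioo 0 T ×ˢ ball y ρ, ‖v z.1 z.2‖ₑ ^ (3 : ℕ) ≤
      K * (∫⁻ z in Ioo 0 T ×ˢ ball y ρ, ‖v z.1 z.2‖ₑ ^ (2 : ℕ)) ^ (1 / 4 : ℝ) := by
    intro y
    set B := ball y ρ with hB
    set Bo : Opens (EuclideanSpace ℝ (Fin 3)) := ⟨B, isOpen_ball⟩ with hBo
    set μt : Measure ℝ := volume.restrict (Ioo (0 : ℝ) T) with hμt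
    set μx := (volume.restrict B : Measure (EuclideanSpace ℝ (Fin 3))) with hμx
    have hprod : μt.prod μx = volume.restrict (Ioo 0 T ×ˢ B) := by
      rw [hμt, hμx, Measure.prod_restrict, ← Measure.volume_eq_prod]
    have hsub : Ioo 0 T ×ˢ B ⊆ Ioi (0 : ℝ) ×ˢ univ :=
      Set.prod_mono Ioo_subset_Ioi_self (subset_univ _)
    -- measurability on the box
    have hvmB : AEStronglyMeasurable (uncurry v) (μt.prod μx) := by
      rw [hprod]
      exact hvm.mono_measure (Measure.restrict_mono hsub le_rfl)
    have hGmB : AEStronglyMeasurable (uncurry G) (μt.prod μx) := by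
      rw [hprod]
      exact hGm.mono_measure (Measure.restrict_mono hsub le_rfl)
    have hF3 : AEMeasurable
        (fun z : ℝ × EuclideanSpace ℝ (Fin 3) => ‖v z.1 z.2‖ₑ ^ (3 : ℕ)) (μt.prod μx) :=
      hvmB.enorm.pow_const _
    have hF2 : AEMeasurable
        (fun z : ℝ × EuclideanSpace ℝ (Fin 3) => ‖v z.1 z.2‖ₑ ^ (2 : ℕ)) (μt.prod μx) :=
      hvmB.enorm.pow_const _
    have hFg : AEMeasurable (fun z : ℝ × EuclideanSpace ℝ (Fin 3) =>
        ENNReal.ofReal (frobeniusNormSq (G z.1 z.2))) (μt.prod μx) :=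
      (continuous_frobeniusNormSq'.comp_aestronglyMeasurable hGmB).aemeasurable.ennreal_ofReal
    -- slice quantities and Tonelli
    set a : ℝ → ℝ≥0∞ := fun s => ∫⁻ x in B, ‖v s x‖ₑ ^ (2 : ℕ) with ha
    set e : ℝ → ℝ≥0∞ := fun s => ∫⁻ x in B, ENNReal.ofReal (frobeniusNormSq (G s x))
      with he
    set g₃ : ℝ → ℝ≥0∞ := fun s => ∫⁻ x in B, ‖v s x‖ₑ ^ (3 : ℕ) with hg₃
    have ha_meas : AEMeasurable a μt := hF2.lintegral_prod_right'
    have he_meas : AEMeasurable e μt := hFg.lintegral_prod_right'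
    have hT3 : ∫⁻ z in Ioo 0 T ×ˢ B, ‖v z.1 z.2‖ₑ ^ (3 : ℕ) = ∫⁻ s, g₃ s ∂μt := by
      rw [← hprod, lintegral_prod _ hF3]
    have hT2 : ∫⁻ z in Ioo 0 T ×ˢ B, ‖v z.1 z.2‖ₑ ^ (2 : ℕ) = ∫⁻ s, a s ∂μt := by
      rw [← hprod, lintegral_prod _ hF2]
    have hTg : ∫⁻ z in Ioo 0 T ×ˢ B, ENNReal.ofReal (frobeniusNormSq (G z.1 z.2)) =
        ∫⁻ s, e s ∂μt := by
      rw [← hprod, lintegral_prod _ hFg]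
    -- a.e. in `s`: the slice weak derivative and the energy bound
    set Qb : Opens (ℝ × EuclideanSpace ℝ (Fin 3)) :=
      ⟨Ioo 0 T ×ˢ (Bo : Set (EuclideanSpace ℝ (Fin 3))), isOpen_Ioo.prod Bo.isOpen⟩ with hQb
    have hle : Qb ≤ slab (EuclideanSpace ℝ (Fin 3)) (Ioi 0) isOpen_Ioi := by
      show (Qb : Set (ℝ × EuclideanSpace ℝ (Fin 3))) ⊆ _
      rw [hslab]
      exact hsub
    have hslice : ∀ᵐ s ∂μt, FunctionSpaces.HasWeakFDerivOn Bo volume (v s) (G s) :=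
      (hG.mono hle).ae_hasWeakFDerivOn_slice
    have henergy : ∀ᵐ s ∂μt, a s ≤ C₁ := by
      have h1 := ae_restrict_of_ae_restrict_of_subset (Ioo_subset_Ioo le_rfl hTR) hC₁
      filter_upwards [h1] with s hs
      exact (lintegral_mono_set (ball_subset_ball hρR)).trans (hs y)
    -- the pointwise slice bound
    have hpt : ∀ᵐ s ∂μt, g₃ s ≤ C₃ * (a s ^ (1 / 4 : ℝ) * (a s + e s) ^ (3 / 4 : ℝ)) := by
      filter_upwards [hslice, henergy] with s hs hen
      have h2 : eLpNorm (v s) 2 μx ≠ ∞ := by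
        rw [hμx, eLpNorm_two_eq_rpow_lintegral_sq]
        exact ENNReal.rpow_ne_top_of_nonneg (by norm_num)
          (ne_top_of_le_ne_top ENNReal.coe_ne_top hen)
      have hsl := lintegral_cube_le_of_sobolev μx (hCS y (v s) (G s) hs h2)
        hs.locallyIntegrableOn.aestronglyMeasurable
      have h34 : a s ^ (3 / 4 : ℝ) = a s ^ (1 / 4 : ℝ) * a s ^ (1 / 2 : ℝ) := by
        rw [← ENNReal.rpow_add_of_nonneg _ _ (by norm_num) (by norm_num)]
        norm_num
      have hhalf : a s ^ (1 / 2 : ℝ) ≤ (C₁ : ℝ≥0∞) ^ (1 / 2 : ℝ) :=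
        ENNReal.rpow_le_rpow hen (by norm_num)
      calc g₃ s ≤ ((2 : ℝ≥0∞) * CS) ^ (3 / 2 : ℝ) * a s ^ (3 / 4 : ℝ) *
            (a s + e s) ^ (3 / 4 : ℝ) := hsl
        _ = ((2 : ℝ≥0∞) * CS) ^ (3 / 2 : ℝ) * (a s ^ (1 / 4 : ℝ) * a s ^ (1 / 2 : ℝ)) *
            (a s + e s) ^ (3 / 4 : ℝ) := by rw [h34]
        _ ≤ ((2 : ℝ≥0∞) * CS) ^ (3 / 2 : ℝ) *
            (a s ^ (1 / 4 : ℝ) * (C₁ : ℝ≥0∞) ^ (1 / 2 : ℝ)) * (a s + e s) ^ (3 / 4 : ℝ) := by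
          gcongr
        _ = C₃ * (a s ^ (1 / 4 : ℝ) * (a s + e s) ^ (3 / 4 : ℝ)) := by rw [hC₃]; ring
    -- the time integrals of `a` and `e`
    have hIa : ∫⁻ s, a s ∂μt ≤ (C₁ : ℝ≥0∞) * ENNReal.ofReal T := by
      calc ∫⁻ s, a s ∂μt ≤ ∫⁻ _, (C₁ : ℝ≥0∞) ∂μt := lintegral_mono_ae henergy
        _ = (C₁ : ℝ≥0∞) * ENNReal.ofReal T := by
            rw [lintegral_const, hμt, Measure.restrict_apply_univ, Real.volume_Ioo, sub_zero]
    have hIe : ∫⁻ s, e s ∂μt ≤ C₂ := by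
      rw [← hTg]
      exact (lintegral_mono_set (Set.prod_mono (Ioo_subset_Ioo le_rfl hTR)
        (ball_subset_ball hρR))).trans (hC₂ y)
    have hIae : ∫⁻ s, (a s + e s) ∂μt ≤ (C₁ : ℝ≥0∞) * ENNReal.ofReal T + C₂ := by
      rw [lintegral_add_left' ha_meas]
      exact add_le_add hIa hIe
    -- integrate the slice bound
    calc ∫⁻ z in Ioo 0 T ×ˢ B, ‖v z.1 z.2‖ₑ ^ (3 : ℕ) = ∫⁻ s, g₃ s ∂μt := hT3
      _ ≤ ∫⁻ s, C₃ * (a s ^ (1 / 4 : ℝ) * (a s + e s) ^ (3 / 4 : ℝ)) ∂μt :=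
          lintegral_mono_ae hpt
      _ = C₃ * ∫⁻ s, a s ^ (1 / 4 : ℝ) * (a s + e s) ^ (3 / 4 : ℝ) ∂μt :=
          lintegral_const_mul' _ _ hC₃top
      _ ≤ C₃ * ((∫⁻ s, a s ∂μt) ^ (1 / 4 : ℝ) * (∫⁻ s, (a s + e s) ∂μt) ^ (3 / 4 : ℝ)) := by
          gcongr
          exact lintegral_rpow_quarter_mul_le μt ha_meas (ha_meas.add he_meas)
      _ ≤ C₃ * ((∫⁻ s, a s ∂μt) ^ (1 / 4 : ℝ) *
            ((C₁ : ℝ≥0∞) * ENNReal.ofReal T + C₂) ^ (3 / 4 : ℝ)) := by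
          gcongr
      _ = K * (∫⁻ z in Ioo 0 T ×ˢ B, ‖v z.1 z.2‖ₑ ^ (2 : ℕ)) ^ (1 / 4 : ℝ) := by
          rw [hT2, hK]
          ring
  -- ## conclusion: squeeze between `0` and `K (∫∫ |v|²)^{1/4} → 0`
  have h2T : Tendsto (fun y => ∫⁻ z in Ioo 0 T ×ˢ ball y ρ, ‖v z.1 z.2‖ₑ ^ (2 : ℕ))
      (cocompact (EuclideanSpace ℝ (Fin 3))) (𝓝 0) :=
    tendsto_of_tendsto_of_tendsto_of_le_of_le tendsto_const_nhds hdec (fun _ => zero_le)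
      fun y => lintegral_mono_set
        (Set.prod_mono (Ioo_subset_Ioo le_rfl hTR) (ball_subset_ball hρR))
  have hr : Tendsto (fun y =>
      (∫⁻ z in Ioo 0 T ×ˢ ball y ρ, ‖v z.1 z.2‖ₑ ^ (2 : ℕ)) ^ (1 / 4 : ℝ))
      (cocompact (EuclideanSpace ℝ (Fin 3))) (𝓝 0) := by
    have := (ENNReal.continuous_rpow_const (y := (1 / 4 : ℝ))).tendsto (0 : ℝ≥0∞)
    rw [ENNReal.zero_rpow_of_pos (by norm_num)] at this
    exact this.comp h2T
  have hK0 := ENNReal.Tendsto.const_mul hr (Or.inr hKtop) (a := K)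
  rw [mul_zero] at hK0
  exact tendsto_of_tendsto_of_tendsto_of_le_of_le tendsto_const_nhds hK0 (fun _ => zero_le) key

end Literature.Analysis.FluidPDE
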